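import Summits.RiemannHypothesis.RiemannHypothesis.Theses.LeeYang
import Summits.RiemannHypothesis.RiemannHypothesis.Theorems.LeeYangLeeyangNegStubBoundary

/-!
# Skeleton v2 — crux `LeeYang.LeeyangNeg` (stmt-RiemannHypothesis-0457), line `Sketch`
(idea card `Cruxes/LeeyangNeg/Ideas/heatflow-product-towers.md`, ideator round 1; lead
prover-line-stmt-RiemannHypothesis-0457-0, 2026-08-16)

The crux is `¬ IsIsingLimitLaw ν_Φ` for the de Bruijn law `ν_Φ = Φ du / ∫Φ`
(`Φ = Literature.NumberTheory.LFunctions.deBruijnPhi`). The line's transfer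
`K0 ∧ K12 ∧ K3 ⇒ LeeyangNeg` is composed here from three registered stubs, all signatures inline
(no local definitions):

* `stub_boundary` (K0, LANDED p103378 as `Theorems/LeeYangLeeyangNegStubBoundary.lean`, imported; from the CLOSED tree theorem
  `Literature.NumberTheory.LFunctions.rodgers_tao_holds`, Newman's conjecture `Λ ≥ 0`): `ν_Φ` sits
  exactly on the Lee–Yang boundary — for every `c > 0` the Gaussian anti-tilt `e^{-cu²} ν_Φ` does NOT
  have the Lee–Yang property (its Laplace transform is `2 H_{-c}(iz) / ∫Φ`, and `H_{-c}` has a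
  non-real zero).
* `stub_decomp` (K1 ∧ K2 of the card, merged into one statement in the tree's vocabulary, no
  tower class needed): an Ising limit law on the Lee–Yang boundary (every Gaussian anti-tilt fails
  Lee–Yang) is a NON-TRIVIAL SYMMETRIC CONVOLUTION `μ₁ ∗ μ₂` (both factors even, neither `δ₀`).
  Heuristic of the card: inside product/heat-flow towers a heat-flow step of time `c` leaves margin
  `Λ ≤ -c`, so an element with `Λ = 0` ends in a product; K1 = towers are dense. For FINITE
  ferromagnets the statement is conjecture R0 of the crux NOTES §1d (connected coupling graph ⇒
  `Λ < 0`; disconnected ⇒ the law is the convolution of the block laws).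
* `stub_indecomp` (K3, `PhiIndecomposableEven` of the ideator's Sketch): `ν_Φ` is not such a
  convolution (transform form: no splitting `A ⊔ B` of the zeros of `Ξ` makes both half Hadamard
  products positive-definite).

`LeeyangNeg_of` concludes the crux BY NAME from the three stubs (sorry only in stubs).
-/

noncomputable section

-- the sub-problem path `RiemannHypothesis/RiemannHypothesis` (single-conjunct summit, D-0017) duplicates a namespace
set_option linter.dupNamespace false

open MeasureTheory

namespace Summit.RiemannHypothesis.RiemannHypothesis.Theorems.LeeYangProductTowers

open Literature.Probability.LatticeModels Literature.NumberTheory.LFunctions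

-- stub_boundary (K0): LANDED p103378 — imported from
-- `Summits.RiemannHypothesis.RiemannHypothesis.Theorems.LeeYangLeeyangNegStubBoundary` (same namespace and name).

/-- **Stub K12 — Ising limit laws on the Lee–Yang boundary are decomposable.** If `ν` is an Ising
limit law and no Gaussian anti-tilt `e^{-cu²} ν` (`c > 0`) has the Lee–Yang property, then `ν` is
the convolution of two EVEN probability measures, neither of which is `δ₀`. (Dirac and two-point
laws are excluded by the hypothesis: their anti-tilts are again Dirac/two-point and Lee–Yang.) -/
theorem stub_decomp : ∀ ν : ProbabilityMeasure ℝ, IsIsingLimitLaw ν →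
    (∀ c : ℝ, 0 < c →
      ¬ HasLeeYangProperty
        ((ν : Measure ℝ).withDensity fun u => ENNReal.ofReal (Real.exp (-(c * u ^ 2))))) →
    ∃ μ₁ μ₂ : ProbabilityMeasure ℝ,
      (μ₁ : Measure ℝ).map Neg.neg = μ₁ ∧ (μ₂ : Measure ℝ).map Neg.neg = μ₂ ∧
      (μ₁ : Measure ℝ) ≠ Measure.dirac 0 ∧ (μ₂ : Measure ℝ) ≠ Measure.dirac 0 ∧
      (ν : Measure ℝ) = Measure.conv (μ₁ : Measure ℝ) (μ₂ : Measure ℝ) := by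
  sorry

/-- **Stub K3 — `ν_Φ` is symmetric-indecomposable.** The de Bruijn law is not the convolution of
two even probability measures both different from `δ₀` (equivalently, by Raikov–Linnik–Ostrovskii
and the doubly-exponential tails of `Φ`: no splitting of the zero set of `Ξ` into two parts makes
both half Hadamard products characteristic functions). -/
theorem stub_indecomp : ∀ ν : ProbabilityMeasure ℝ,
    (ν : Measure ℝ) = (∫⁻ u, ENNReal.ofReal (deBruijnPhi u))⁻¹ •
        volume.withDensity (fun u => ENNReal.ofReal (deBruijnPhi u)) →
    ¬ ∃ μ₁ μ₂ : ProbabilityMeasure ℝ,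
      (μ₁ : Measure ℝ).map Neg.neg = μ₁ ∧ (μ₂ : Measure ℝ).map Neg.neg = μ₂ ∧
      (μ₁ : Measure ℝ) ≠ Measure.dirac 0 ∧ (μ₂ : Measure ℝ) ≠ Measure.dirac 0 ∧
      (ν : Measure ℝ) = Measure.conv (μ₁ : Measure ℝ) (μ₂ : Measure ℝ) := by
  sorry

/-- **Composition.** The crux `LeeyangNeg` (`¬ IsIsingLimitLaw ν_Φ`) from the three stubs: an
Ising-limit witness for `ν_Φ` would sit on the Lee–Yang boundary (K0), hence decompose (K12),
contradicting K3. -/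
theorem LeeyangNeg_of :
    Summit.RiemannHypothesis.RiemannHypothesis.Theses.LeeYang.LeeyangNeg := by
  intro ν hν hGS
  exact stub_indecomp ν hν (stub_decomp ν hGS (stub_boundary ν hν))

end Summit.RiemannHypothesis.RiemannHypothesis.Theorems.LeeYangProductTowers

end
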